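import Summits.QuantumFields.GaugeBoot.DiagonalRPTorusPolyakovLadder
import HarnessLib

/-!
# The value of the ladder integral (gauge-boot, task L3(ξ))

HONEST FRAMING (cell `pub-gaugeboot`, page 1 of every file): the venture produces certified bounds
on lattice expectations at stated coupling, gauge group, dimension and torus size; NOT a mass gap,
NOT a continuum limit, NOT a string tension; NOT Yang–Mills-summit-bearing (barriers
`FixedCouplingUltralocality`, `PerturbativeInvisibility`). This module finishes the computation
of the LEADING strong-coupling coefficient used by the structural NEGATIVE result
`DiagonalRPTorusNegativeOddSUN`; it discharges nothing by itself.

## Content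

Continuing `DiagonalRPTorusPolyakovLadder` (`J_1 = c₁^{L-1} J_L`): the last stage
`J_L = ∫ Re χ(𝔄) Re χ(𝔅) Re χ(𝔅⁻¹ r_0 𝔄 r_0⁻¹)` is evaluated by resampling the rung `r_0`
with the class identity (R2) (`integral_stage_last`), then the bottom link of each column with
right invariance of Haar measure (`integral_twoLoop`, `integral_oneLoop`):
**`ladderIntegral_eq`** `I(A,B) = c₁^{L-1} c₂ (V₀² + V₁²)`, `V₀ = ∫ (Re χ)²`
(`PlaquetteLowerBound.charVariance`), `V₁ = ∫ Re χ Im χ` (`charMixed`), and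
**`ladderIntegral_pos`**: `I(A,B) > 0` whenever `c₁, c₂ > 0` and `N ≥ 1`.
Elementary; no definition of substance (`imTr`, `twoLoop`, `oneLoop` are abbreviations of
integrands), no named fact.
-/

open MeasureTheory Complex Finset Function
open scoped ComplexOrder

namespace Summit.QuantumFields.GaugeBoot

open Literature.MathematicalPhysics.QuantumFieldTheory
open Literature.MathematicalPhysics.QuantumFieldTheory.PlaquetteLowerBound (reTr charVariance)
open Literature.RepresentationTheory.CompactGroups

noncomputable section

namespace DiagRPSUN

open DiagRPThree DiagRPPolyakov

section Value

variable {L : ℕ} [NeZero L] {N : ℕ} {G : Type*} [Group G] [TopologicalSpace G]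
  [IsTopologicalGroup G] [CompactSpace G] [MeasurableSpace G] [BorelSpace G]
  [SecondCountableTopology G] (ρ : G →* Matrix (Fin N) (Fin N) ℂ)
  (pl : {q : Fin 3 × Fin 3 // q.1 < q.2}) (B : ZMod L × ZMod L)

/-- `Im χ = Im tr ρ`. -/
def imTr (g : G) : ℝ := ((ρ g).trace).im

/-- The two-loop integrand `Re χ(𝔄) Re χ(𝔅) (Re χ(𝔄) Re χ(𝔅) + Im χ(𝔄) Im χ(𝔅))` left after the
rungs are integrated out (`𝔄`, `𝔅` the two Polyakov holonomies). -/
def twoLoop (U : GaugeConfig 3 L G) : ℝ :=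
  reTr ρ (colHol (bump pl.1.1 B) L U) * reTr ρ (colHol B L U) *
    (reTr ρ (colHol (bump pl.1.1 B) L U) * reTr ρ (colHol B L U) +
      imTr ρ (colHol (bump pl.1.1 B) L U) * imTr ρ (colHol B L U))

/-- The one-loop integrand `V₀ Re χ(𝔅)² + V₁ Re χ(𝔅) Im χ(𝔅)` left after the column `A` is
integrated out. -/
def oneLoop (U : GaugeConfig 3 L G) : ℝ :=
  charVariance ρ * reTr ρ (colHol B L U) ^ 2 +
    charMixed ρ * (reTr ρ (colHol B L U) * imTr ρ (colHol B L U))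

omit [NeZero L] [TopologicalSpace G] [IsTopologicalGroup G] [CompactSpace G] [MeasurableSpace G]
  [BorelSpace G] [SecondCountableTopology G] in
/-- The last stage integrand: `Re χ(𝔄) Re χ(𝔅) Re χ(𝔅⁻¹ r_0 𝔄 r_0⁻¹)`. -/
theorem stageIntegrand_last (U : GaugeConfig 3 L G) :
    stageIntegrand ρ pl B L U = reTr ρ (colHol (bump pl.1.1 B) L U) * reTr ρ (colHol B L U) *
      reTr ρ ((colHol B L U)⁻¹ * U (vsite B 0, pl.1.1) * colHol (bump pl.1.1 B) L U *
        (U (vsite B 0, pl.1.1))⁻¹) := by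
  unfold stageIntegrand ladderWord polRe colHol reTr
  rw [ZMod.natCast_self, Ico_self, prod_empty, mul_one]

omit [NeZero L] [IsTopologicalGroup G] [CompactSpace G] [MeasurableSpace G] [BorelSpace G]
  [SecondCountableTopology G] in
/-- `Im χ` of a continuous configuration functional is continuous. -/
theorem continuous_imTr_comp (hρ : Continuous ρ) {f : GaugeConfig 3 L G → G} (hf : Continuous f) :
    Continuous fun U => imTr ρ (f U) :=
  Complex.continuous_im.comp (hρ.matrix_trace.comp hf)

omit [NeZero L] [CompactSpace G] [MeasurableSpace G] [BorelSpace G] [SecondCountableTopology G] in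
/-- The two-loop integrand is continuous. -/
theorem continuous_twoLoop (hρ : Continuous ρ) : Continuous (twoLoop ρ pl B) := by
  unfold twoLoop colHol
  have hA := continuous_lineHolonomy (L := L) (G := G) 2 L (vsite (bump pl.1.1 B) 0)
  have hB := continuous_lineHolonomy (L := L) (G := G) 2 L (vsite B 0)
  exact ((continuous_reTr_comp ρ hρ hA).mul (continuous_reTr_comp ρ hρ hB)).mul
    (((continuous_reTr_comp ρ hρ hA).mul (continuous_reTr_comp ρ hρ hB)).add
      ((continuous_imTr_comp ρ hρ hA).mul (continuous_imTr_comp ρ hρ hB)))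

omit [NeZero L] [SecondCountableTopology G] in
/-- The one-loop integrand is continuous. -/
theorem continuous_oneLoop (hρ : Continuous ρ) : Continuous (oneLoop ρ B) := by
  unfold oneLoop colHol
  have hB := continuous_lineHolonomy (L := L) (G := G) 2 L (vsite B 0)
  exact (continuous_const.mul ((continuous_reTr_comp ρ hρ hB).pow 2)).add
    (continuous_const.mul ((continuous_reTr_comp ρ hρ hB).mul (continuous_imTr_comp ρ hρ hB)))

/-! ### Resampling the rung `r_0` with (R2) -/

/-- **`J_L = c₂ ∫ twoLoop`** (resample `r_0 = U(vsite B 0, a)` with the class identity (R2);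
`χ(𝔅⁻¹) = conj χ(𝔅)`). -/
theorem integral_stage_last (hpl : pl.1.2 = 2) (hρ : Continuous ρ) {c₂ : ℝ}
    (hR2 : ∀ x y : G, ∫ g, reTr ρ (g * x * g⁻¹ * y) ∂haarProbability G =
      c₂ * ((ρ x).trace * (ρ y).trace).re) :
    ∫ U, stageIntegrand ρ pl B L U ∂Measure.pi (fun _ : Edge 3 L => haarProbability G) =
      c₂ * ∫ U, twoLoop ρ pl B U ∂Measure.pi (fun _ : Edge 3 L => haarProbability G) := by
  have ha := fst_ne_two pl hpl
  set a : Fin 3 := pl.1.1 with ha_def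
  set e : Edge 3 L := (vsite B 0, a) with he
  rw [← integral_const_mul]
  refine integral_pi_update_of_forall (haarProbability G) e
    (integrable_of_continuous_config (continuous_stageIntegrand ρ pl B hρ L)) fun U => ?_
  have hcol : ∀ (C : ZMod L × ZMod L) (s : G), colHol C L (update U e s) = colHol C L U :=
    fun C s => by unfold colHol; rw [lineHolonomy_update_of_snd_ne_two ha]
  set gA : G := colHol (bump a B) L U with hgA
  set gB : G := colHol B L U with hgB
  have hF : ∀ s : G, stageIntegrand ρ pl B L (update U e s) =
      reTr ρ gA * reTr ρ gB * reTr ρ (s * gA * s⁻¹ * gB⁻¹) := fun s => by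
    rw [stageIntegrand_last, ← ha_def, hcol, hcol, ← he, update_self, ← hgA, ← hgB,
      show gB⁻¹ * s * gA * s⁻¹ = gB⁻¹ * (s * gA * s⁻¹) by group, reTr_mul_comm ρ gB⁻¹]
  simp_rw [hF]
  rw [integral_const_mul, hR2 gA gB⁻¹, CompactGroup.trace_map_inv ρ hρ]
  unfold twoLoop
  rw [← ha_def, ← hgA, ← hgB]
  unfold reTr imTr
  simp only [Complex.mul_re, Complex.conj_re, Complex.conj_im]
  ring

/-! ### Resampling the bottom links with right invariance -/

omit [NeZero L] [TopologicalSpace G] [IsTopologicalGroup G] [CompactSpace G] [MeasurableSpace G]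
  [BorelSpace G] [SecondCountableTopology G] in
/-- The upper part of a column does not read the bottom link (`L ≥ 1` heights `1, …, L-1`). -/
theorem lineHolonomy_upper_update (hL : 0 < L) {U : GaugeConfig 3 L G} {s : G}
    (A : ZMod L × ZMod L) :
    lineHolonomy (update U (vsite A 0, (2 : Fin 3)) s) 2 (L - 1) (vsite A 1) =
      lineHolonomy U 2 (L - 1) (vsite A 1) := by
  haveI : NeZero L := ⟨hL.ne'⟩
  refine lineHolonomy_update_of_ne A 1 (L - 1) fun t ht h => ?_
  have h2 : (1 : ZMod L) + (t : ZMod L) = 0 := (vsite_eq_vsite_iff.1 (congrArg Prod.fst h)).2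
  have h3 : (((1 + t : ℕ) : ZMod L)) = ((0 : ℕ) : ZMod L) := by push_cast; exact h2
  have := (natCast_eq_natCast_iff_of_lt (by omega) hL).1 h3
  omega

omit [SecondCountableTopology G] in
/-- Right invariance in the form used twice: `∫ f(Re χ(s w), Im χ(s w)) ds = ∫ f(Re χ s, Im χ s) ds`
for the two quadratic integrands. -/
theorem integral_quadratic_mul_right (hρ : Continuous ρ) (w : G) (p q : ℝ) :
    ∫ s, (p * reTr ρ (s * w) ^ 2 + q * (reTr ρ (s * w) * imTr ρ (s * w))) ∂haarProbability G =
      p * charVariance ρ + q * charMixed ρ := by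
  have h := integral_mul_right_eq_self (μ := haarProbability G)
    (fun g : G => p * reTr ρ g ^ 2 + q * (reTr ρ g * imTr ρ g)) w
  rw [h]
  have hc1 : Continuous fun g : G => reTr ρ g ^ 2 :=
    (PlaquetteLowerBound.continuous_reTr ρ hρ).pow 2
  have hc2 : Continuous fun g : G => reTr ρ g * imTr ρ g :=
    (PlaquetteLowerBound.continuous_reTr ρ hρ).mul (Complex.continuous_im.comp hρ.matrix_trace)
  rw [integral_add ((hc1.integrable_of_hasCompactSupport (HasCompactSupport.of_compactSpace _)).const_mul p)
      ((hc2.integrable_of_hasCompactSupport (HasCompactSupport.of_compactSpace _)).const_mul q),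
    integral_const_mul, integral_const_mul]
  rfl

/-- **Integrating out the column `A`**: `∫ twoLoop = ∫ oneLoop` (resample the bottom link
`a_0`; `𝔄 = a_0 𝔄'` and Haar measure is right invariant). -/
theorem integral_twoLoop (hpl : pl.1.2 = 2) (hρ : Continuous ρ) (hL : 1 < L) :
    ∫ U, twoLoop ρ pl B U ∂Measure.pi (fun _ : Edge 3 L => haarProbability G) =
      ∫ U, oneLoop ρ B U ∂Measure.pi (fun _ : Edge 3 L => haarProbability G) := by
  have ha := fst_ne_two pl hpl
  have hL0 : 0 < L := by omega
  set a : Fin 3 := pl.1.1 with ha_def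
  set A := bump a B with hA
  have hAB : B ≠ A := fun h => bump_ne_self hL ha B (by rw [← hA, ← h])
  set e : Edge 3 L := (vsite A 0, (2 : Fin 3)) with he
  refine integral_pi_update_of_forall (haarProbability G) e
    (integrable_of_continuous_config (continuous_twoLoop ρ pl B hρ)) fun U => ?_
  have hsplit : ∀ V : GaugeConfig 3 L G,
      colHol A L V = V (vsite A 0, 2) * lineHolonomy V 2 (L - 1) (vsite A 1) := fun V => by
    unfold colHol
    rw [lineHolonomy_eq_mul V 2 hL0, vsite_shift_two, zero_add]
  have hup : ∀ s : G, lineHolonomy (update U e s) 2 (L - 1) (vsite A 1) =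
      lineHolonomy U 2 (L - 1) (vsite A 1) := fun s => lineHolonomy_upper_update hL0 A
  have hB : ∀ s : G, colHol B L (update U e s) = colHol B L U := fun s => by
    unfold colHol
    exact lineHolonomy_update_of_col_ne hAB 0 0 L
  set w : G := lineHolonomy U 2 (L - 1) (vsite A 1) with hw
  set gB : G := colHol B L U with hgB
  have hF : ∀ s : G, twoLoop ρ pl B (update U e s) =
      reTr ρ gB ^ 2 * reTr ρ (s * w) ^ 2 +
        reTr ρ gB * imTr ρ gB * (reTr ρ (s * w) * imTr ρ (s * w)) := fun s => by
    unfold twoLoop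
    rw [← ha_def, ← hA, hsplit, hup, hB, ← he, update_self]
    ring
  simp_rw [hF]
  rw [integral_quadratic_mul_right ρ hρ]
  unfold oneLoop
  rw [← hgB]
  ring

/-- **Integrating out the column `B`**: `∫ oneLoop = V₀² + V₁²`. -/
theorem integral_oneLoop (hρ : Continuous ρ) :
    ∫ U, oneLoop ρ B U ∂Measure.pi (fun _ : Edge 3 L => haarProbability G) =
      charVariance ρ ^ 2 + charMixed ρ ^ 2 := by
  have hL0 : 0 < L := NeZero.pos L
  set e : Edge 3 L := (vsite B 0, (2 : Fin 3)) with he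
  suffices key : ∀ U : GaugeConfig 3 L G,
      ∫ s, oneLoop ρ B (update U e s) ∂haarProbability G = charVariance ρ ^ 2 + charMixed ρ ^ 2 by
    rw [integral_pi_update_of_forall (haarProbability G) e
      (integrable_of_continuous_config (continuous_oneLoop ρ B hρ)) key, integral_const, smul_eq_mul,
      probReal_univ, one_mul]
  intro U
  have hsplit : ∀ V : GaugeConfig 3 L G,
      colHol B L V = V (vsite B 0, 2) * lineHolonomy V 2 (L - 1) (vsite B 1) := fun V => by
    unfold colHol
    rw [lineHolonomy_eq_mul V 2 hL0, vsite_shift_two, zero_add]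
  have hup : ∀ s : G, lineHolonomy (update U e s) 2 (L - 1) (vsite B 1) =
      lineHolonomy U 2 (L - 1) (vsite B 1) := fun s => lineHolonomy_upper_update hL0 B
  set w : G := lineHolonomy U 2 (L - 1) (vsite B 1) with hw
  have hF : ∀ s : G, oneLoop ρ B (update U e s) =
      charVariance ρ * reTr ρ (s * w) ^ 2 +
        charMixed ρ * (reTr ρ (s * w) * imTr ρ (s * w)) := fun s => by
    unfold oneLoop
    rw [hsplit, hup, ← he, update_self]
  simp_rw [hF]
  rw [integral_quadratic_mul_right ρ hρ]
  ring

/-! ### The value and the sign of the ladder integral -/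

/-- ★ **The ladder integral, evaluated**: under (R1) and (R2),
`I(A,B) = c₁^{L-1} c₂ (V₀² + V₁²)`. -/
theorem ladderIntegral_eq (hpl : pl.1.2 = 2) (hρ : Continuous ρ) (hL : 1 < L) {c₁ c₂ : ℝ}
    (hR1 : ∀ x y : G, ∫ g, reTr ρ (x * g⁻¹) * reTr ρ (g * y) ∂haarProbability G =
      c₁ * reTr ρ (x * y))
    (hR2 : ∀ x y : G, ∫ g, reTr ρ (g * x * g⁻¹ * y) ∂haarProbability G =
      c₂ * ((ρ x).trace * (ρ y).trace).re) :
    ladderIntegral ρ pl B = c₁ ^ (L - 1) * (c₂ * (charVariance ρ ^ 2 + charMixed ρ ^ 2)) := by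
  rw [ladderIntegral_eq_stage_one ρ pl B hpl, stage_one_eq ρ pl B hpl hρ hR1,
    integral_stage_last ρ pl B hpl hρ hR2, integral_twoLoop ρ pl B hpl hρ hL,
    integral_oneLoop ρ B hρ]

/-- ★ **The ladder integral is positive**: `I(A,B) ≥ c₁^{L-1} c₂ V₀² > 0` for `c₁, c₂ > 0`,
`N ≥ 1` (`V₀ > 0`: `PlaquetteLowerBound.charVariance_pos`). -/
theorem ladderIntegral_pos (hpl : pl.1.2 = 2) (hρ : Continuous ρ) (hL : 1 < L) (hN : 1 ≤ N)
    {c₁ c₂ : ℝ} (hc₁ : 0 < c₁) (hc₂ : 0 < c₂)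
    (hR1 : ∀ x y : G, ∫ g, reTr ρ (x * g⁻¹) * reTr ρ (g * y) ∂haarProbability G =
      c₁ * reTr ρ (x * y))
    (hR2 : ∀ x y : G, ∫ g, reTr ρ (g * x * g⁻¹ * y) ∂haarProbability G =
      c₂ * ((ρ x).trace * (ρ y).trace).re) :
    0 < ladderIntegral ρ pl B := by
  rw [ladderIntegral_eq ρ pl B hpl hρ hL hR1 hR2]
  have hV := PlaquetteLowerBound.charVariance_pos ρ hρ hN
  positivity

end Value

end DiagRPSUN

end

end Summit.QuantumFields.GaugeBoot
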